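import Summits.Ventures.YMGap.RobustBall.MassGapOnBallZdSMassive
import Summits.Ventures.YMGap.RobustBall.RowsSN
import HarnessLib

/-!
# Venture YMGap, track ROBUST-BALL (tier 2) — the certified cells of §5 row 1g as MASSIVE rows
# (`SU(2)`, `d = 4`, weight `e^{t} = q`)

HONEST FRAMING. WHAT THIS IS: a venture file (cell `pub-ymgap`, track Y2 ROBUST-BALL, seat ds-3). rb-p1's
`RowsS.lean` certifies the tier-2 cells `(β⋆_W, ε, q)` of `ROBUST-BALL-STATEMENT.md` §5 row 1g in the currency
`MassGapOnBallZdS 4 2 (β_W/4) (2ε) ε (log q)` from the numeric inequality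
`6 β_W q T(2ε) + T(ε) · 0.8165 · ε < 1` (`T` = the quartic Taylor majorant of `exp_le_taylor4`,
`√(2/3) ≤ 0.8165`). This file reads THE SAME inequality through the seat's tier-2 massive bridge
(`su2_massive_onBallZdS_dim4`): every member of the weighted ball `MemBallZdS (2ε) ε (log q)` — summable,
possibly INFINITE-RANGE link potentials — added to `SU(2)` Wilson at `β_W` on `ℤ⁴` has DLR states, and every DLR
state is an Osterwalder–Seiler MASSIVE STATE with exponentially decaying plaquette–plaquette correlation
function, at the rate `log q` (`su2_massiveS_row`); spelled out for the cells `(1/16, 0.097, 2)`,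
`(1/20, 0.167, 2)`, `(1/20, 0.248, 3/2)`, `(1/16, 0.186, 3/2)`, `(1/10, 0.036, 3/2)` — the `(1/16, 3/2)` and
`(1/20, 2)` cells are those in which rb-p1's infinite-range axial-pair witness (`AxialPairWitness`) is certified
to lie — and the ALL-`N ≥ 2` hypothesis-free cell `(β, a, Λ, e^{t}) = (1/64, 1/20, 1/10, 6/5)` of rb-p1's
`RowsSN.suN_rowS_1_64` (`suN_massiveS_rowS_1_64`, Bakry–Émery door), and the lineage-(B) sharp-variance cells
`(1/16, 0.143, 2)` (the tier-2 twin of the headline radius) and `(1/12, 0.049, 2)` (`su2_massiveS_rowBS`,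
`su2_massiveS_rowBS2_1_16/_1_12`); `SU(3)` CONDITIONALLY on H1/H2: `su3_massiveS_row` + cells `(1/8, 0.199, 3/2)`,
`(1/10, 0.181, 2)` of rb-p1's `RowsSN`. DOOR-LEVEL READING: the hypothesis
carried through the bridge is the ROW CONDITION of each cell (the same certificate inequality, the same door),
not the currency `MassGapOnBallZdS`. WHAT IT IS NOT: no new number (the cells are rb-p1's, rb-ref lineage R);
nothing about the continuum, confinement or the Clay problem.

References: rb-p1 `RowsS.lean` (`su2_rowS`, `su2_rowS2_*`, `su2_rowS32_*`); rb-theory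
`HOME/rb/ROBUST-BALL-STATEMENT.md` §5 row 1g; K. Osterwalder, E. Seiler, Ann. Phys. 110 (1978) 440, §4.
-/

noncomputable section

open MeasureTheory ProbabilityTheory Function Finset Filter Topology
open scoped NNReal
open Literature.Probability.LatticeModels
open Literature.MathematicalPhysics.QuantumLattice
open Literature.MathematicalPhysics.QuantumFieldTheory hiding ZdEdge
open Literature.Barriers.QuantumFields (IsMassiveState)
open Summit.QuantumFields.BalabanUV.InfraRed.StrongCouplingPoincareDoorSUN (OneLinkPoincareSUN)
open Summit.QuantumFields.BalabanUV.InfraRed.StrongCouplingVarianceDoorSUN (OneLinkVarianceBound)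

namespace Summit.Ventures.YMGap.RobustBall

/-- **Tier-2 MASSIVE row from numeric majorants** (`SU(2)`, `d = 4`): at weight `t = log q` (`q > 1`),
oscillation load `2ε` and weighted cross load `ε` (`0 ≤ ε ≤ 1/2`, `β_W ≥ 0`), the certificate inequality
`6 β_W q T(2ε) + T(ε) · 0.8165 · ε < 1` of rb-p1's `su2_rowS` gives: every member of `MemBallZdS (2ε) ε (log q)`
added to `SU(2)` Wilson at `β_W` has DLR states, all MASSIVE (rate `log q`) with plaquette–plaquette decay. -/
theorem su2_massiveS_row {βW ε q : ℝ} (hq : 1 < q) (hβ : 0 ≤ βW) (hε0 : 0 ≤ ε) (hε1 : ε ≤ 1 / 2)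
    (h : 6 * βW * q * (1 + 2 * ε + (2 * ε) ^ 2 / 2 + (2 * ε) ^ 3 / 6 + 5 / 96 * (2 * ε) ^ 4) +
      (1 + ε + ε ^ 2 / 2 + ε ^ 3 / 6 + 5 / 96 * ε ^ 4) * (8165 / 10000) * ε < 1)
    {W : Potential (ZdEdge 4) (Matrix.specialUnitaryGroup (Fin 2) ℂ)} (hW : MemBallZdS (2 * ε) ε (Real.log q) W) :
    (perturbedGibbsMeasuresS (d := 4) (fundamentalRep (Fin 2)) (((2 : ℕ) : ℝ) * (βW / 4)) W).Nonempty ∧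
      ∀ μ ∈ perturbedGibbsMeasuresS (d := 4) (fundamentalRep (Fin 2)) (((2 : ℕ) : ℝ) * (βW / 4)) W,
        IsMassiveState μ ∧ HasExponentialDecay (plaquetteCorrFn (fundamentalRep (Fin 2)) μ) := by
  have hq0 : 0 < q := zero_lt_one.trans hq
  refine su2_massive_onBallZdS_dim4 (Real.log_pos hq) ?_ hW
  have h1 := exp_le_taylor4 (x := 2 * ε) (by linarith) (by linarith)
  have h2 := exp_le_taylor4 (x := ε) hε0 (by linarith)
  rw [abs_of_nonneg hβ, show 2 * ε / 2 = ε by ring, Real.exp_log hq0]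
  calc 6 * βW * (Real.exp (2 * ε) * q) + Real.exp ε * Real.sqrt (2 / 3) * ε
      ≤ 6 * βW * ((1 + 2 * ε + (2 * ε) ^ 2 / 2 + (2 * ε) ^ 3 / 6 + 5 / 96 * (2 * ε) ^ 4) * q) +
        (1 + ε + ε ^ 2 / 2 + ε ^ 3 / 6 + 5 / 96 * ε ^ 4) * (8165 / 10000) * ε := by
        gcongr
        · exact sqrt_two_thirds_le
    _ = 6 * βW * q * (1 + 2 * ε + (2 * ε) ^ 2 / 2 + (2 * ε) ^ 3 / 6 + 5 / 96 * (2 * ε) ^ 4) +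
        (1 + ε + ε ^ 2 / 2 + ε ^ 3 / 6 + 5 / 96 * ε ^ 4) * (8165 / 10000) * ε := by ring
    _ < 1 := h

/-- **Row 1g cell `(β⋆_W, ε, q) = (1/16, 0.097, 2)` is a MASSIVE row** (rb-p1 `su2_rowS2_1_16`): every member of
`MemBallZdS 0.194 0.097 (log 2)` added to `SU(2)` Wilson at `β_W = 1/16` on `ℤ⁴` has DLR states, all massive
(rate `log 2`) with plaquette–plaquette decay. -/
theorem su2_massiveS_rowS2_1_16 {W : Potential (ZdEdge 4) (Matrix.specialUnitaryGroup (Fin 2) ℂ)}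
    (hW : MemBallZdS (2 * (97 / 1000)) (97 / 1000) (Real.log 2) W) :
    (perturbedGibbsMeasuresS (d := 4) (fundamentalRep (Fin 2)) (((2 : ℕ) : ℝ) * ((1 / 16 : ℝ) / 4)) W).Nonempty ∧
      ∀ μ ∈ perturbedGibbsMeasuresS (d := 4) (fundamentalRep (Fin 2)) (((2 : ℕ) : ℝ) * ((1 / 16 : ℝ) / 4)) W,
        IsMassiveState μ ∧ HasExponentialDecay (plaquetteCorrFn (fundamentalRep (Fin 2)) μ) :=
  su2_massiveS_row (by norm_num) (by norm_num) (by norm_num) (by norm_num) (by norm_num) hW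

/-- **Row 1g cell `(β⋆_W, ε, q) = (1/20, 0.167, 2)` is a MASSIVE row** (rb-p1 `su2_rowS2_1_20`; the cell of
rb-p1's axial-pair witness at rate `log 2`). -/
theorem su2_massiveS_rowS2_1_20 {W : Potential (ZdEdge 4) (Matrix.specialUnitaryGroup (Fin 2) ℂ)}
    (hW : MemBallZdS (2 * (167 / 1000)) (167 / 1000) (Real.log 2) W) :
    (perturbedGibbsMeasuresS (d := 4) (fundamentalRep (Fin 2)) (((2 : ℕ) : ℝ) * ((1 / 20 : ℝ) / 4)) W).Nonempty ∧
      ∀ μ ∈ perturbedGibbsMeasuresS (d := 4) (fundamentalRep (Fin 2)) (((2 : ℕ) : ℝ) * ((1 / 20 : ℝ) / 4)) W,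
        IsMassiveState μ ∧ HasExponentialDecay (plaquetteCorrFn (fundamentalRep (Fin 2)) μ) :=
  su2_massiveS_row (by norm_num) (by norm_num) (by norm_num) (by norm_num) (by norm_num) hW

/-- **Row 1g cell `(β⋆_W, ε, q) = (1/20, 0.248, 3/2)` is a MASSIVE row** (rb-p1 `su2_rowS32_1_20`). -/
theorem su2_massiveS_rowS32_1_20 {W : Potential (ZdEdge 4) (Matrix.specialUnitaryGroup (Fin 2) ℂ)}
    (hW : MemBallZdS (2 * (31 / 125)) (31 / 125) (Real.log (3 / 2)) W) :
    (perturbedGibbsMeasuresS (d := 4) (fundamentalRep (Fin 2)) (((2 : ℕ) : ℝ) * ((1 / 20 : ℝ) / 4)) W).Nonempty ∧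
      ∀ μ ∈ perturbedGibbsMeasuresS (d := 4) (fundamentalRep (Fin 2)) (((2 : ℕ) : ℝ) * ((1 / 20 : ℝ) / 4)) W,
        IsMassiveState μ ∧ HasExponentialDecay (plaquetteCorrFn (fundamentalRep (Fin 2)) μ) :=
  su2_massiveS_row (by norm_num) (by norm_num) (by norm_num) (by norm_num) (by norm_num) hW

/-- **Row 1g cell `(β⋆_W, ε, q) = (1/16, 0.186, 3/2)` is a MASSIVE row** (rb-p1 `su2_rowS32_1_16`; the cell of
rb-p1's axial-pair witness at rate `log (3/2)`). -/
theorem su2_massiveS_rowS32_1_16 {W : Potential (ZdEdge 4) (Matrix.specialUnitaryGroup (Fin 2) ℂ)}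
    (hW : MemBallZdS (2 * (93 / 500)) (93 / 500) (Real.log (3 / 2)) W) :
    (perturbedGibbsMeasuresS (d := 4) (fundamentalRep (Fin 2)) (((2 : ℕ) : ℝ) * ((1 / 16 : ℝ) / 4)) W).Nonempty ∧
      ∀ μ ∈ perturbedGibbsMeasuresS (d := 4) (fundamentalRep (Fin 2)) (((2 : ℕ) : ℝ) * ((1 / 16 : ℝ) / 4)) W,
        IsMassiveState μ ∧ HasExponentialDecay (plaquetteCorrFn (fundamentalRep (Fin 2)) μ) :=
  su2_massiveS_row (by norm_num) (by norm_num) (by norm_num) (by norm_num) (by norm_num) hW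

/-- **Largest coupling of the `q = 3/2` column, `(β⋆_W, ε, q) = (1/10, 0.036, 3/2)`, is a MASSIVE row**
(rb-p1 `su2_rowS32_1_10`). -/
theorem su2_massiveS_rowS32_1_10 {W : Potential (ZdEdge 4) (Matrix.specialUnitaryGroup (Fin 2) ℂ)}
    (hW : MemBallZdS (2 * (9 / 250)) (9 / 250) (Real.log (3 / 2)) W) :
    (perturbedGibbsMeasuresS (d := 4) (fundamentalRep (Fin 2)) (((2 : ℕ) : ℝ) * ((1 / 10 : ℝ) / 4)) W).Nonempty ∧
      ∀ μ ∈ perturbedGibbsMeasuresS (d := 4) (fundamentalRep (Fin 2)) (((2 : ℕ) : ℝ) * ((1 / 10 : ℝ) / 4)) W,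
        IsMassiveState μ ∧ HasExponentialDecay (plaquetteCorrFn (fundamentalRep (Fin 2)) μ) :=
  su2_massiveS_row (by norm_num) (by norm_num) (by norm_num) (by norm_num) (by norm_num) hW

/-! ### Lineage (B) at tier 2: the sharp `SU(2)` variance (`β_W ≤ 1/6`) -/

/-- **Tier-2 lineage-(B) MASSIVE row from numeric majorants** (the hypotheses of rb-p1's `su2_rowBS` verbatim:
`√3 ≤ 1.732051`, `√(2/3) ≤ 0.8165`, Taylor `T`; `3 · 1.732051 · β_W q T(2ε) + T(ε) · 0.8165 · ε < 1`,
`0 ≤ β_W ≤ 1/6`): every member of `MemBallZdS (2ε) ε (log q)` added to `SU(2)` Wilson at `β_W` on `ℤ⁴` has DLR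
states, all MASSIVE (rate `log q`) with plaquette–plaquette decay. -/
theorem su2_massiveS_rowBS {βW ε q : ℝ} (hq : 1 < q) (hβ : 0 ≤ βW) (hβ6 : βW ≤ 1 / 6) (hε0 : 0 ≤ ε)
    (hε1 : ε ≤ 1 / 2)
    (h : 3 * (1732051 / 1000000) * βW * q * (1 + 2 * ε + (2 * ε) ^ 2 / 2 + (2 * ε) ^ 3 / 6 + 5 / 96 * (2 * ε) ^ 4) +
      (1 + ε + ε ^ 2 / 2 + ε ^ 3 / 6 + 5 / 96 * ε ^ 4) * (8165 / 10000) * ε < 1)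
    {W : Potential (ZdEdge 4) (Matrix.specialUnitaryGroup (Fin 2) ℂ)} (hW : MemBallZdS (2 * ε) ε (Real.log q) W) :
    (perturbedGibbsMeasuresS (d := 4) (fundamentalRep (Fin 2)) (((2 : ℕ) : ℝ) * (βW / 4)) W).Nonempty ∧
      ∀ μ ∈ perturbedGibbsMeasuresS (d := 4) (fundamentalRep (Fin 2)) (((2 : ℕ) : ℝ) * (βW / 4)) W,
        IsMassiveState μ ∧ HasExponentialDecay (plaquetteCorrFn (fundamentalRep (Fin 2)) μ) := by
  have hq0 : 0 < q := zero_lt_one.trans hq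
  refine su2_massive_onBallZdS_sharp (by rw [abs_of_nonneg hβ]; exact hβ6) (Real.log_pos hq) ?_ hW
  have h1 := exp_le_taylor4 (x := 2 * ε) (by linarith) (by linarith)
  have h2 := exp_le_taylor4 (x := ε) hε0 (by linarith)
  rw [abs_of_nonneg hβ, show 2 * ε / 2 = ε by ring, Real.exp_log hq0]
  calc 3 * Real.sqrt 3 * βW * (Real.exp (2 * ε) * q) + Real.exp ε * Real.sqrt (2 / 3) * ε
      ≤ 3 * (1732051 / 1000000) * βW * ((1 + 2 * ε + (2 * ε) ^ 2 / 2 + (2 * ε) ^ 3 / 6 + 5 / 96 * (2 * ε) ^ 4) * q) +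
        (1 + ε + ε ^ 2 / 2 + ε ^ 3 / 6 + 5 / 96 * ε ^ 4) * (8165 / 10000) * ε := by
        gcongr
        · exact sqrt_three_le_bound
        · exact sqrt_two_thirds_le
    _ = 3 * (1732051 / 1000000) * βW * q * (1 + 2 * ε + (2 * ε) ^ 2 / 2 + (2 * ε) ^ 3 / 6 + 5 / 96 * (2 * ε) ^ 4) +
        (1 + ε + ε ^ 2 / 2 + ε ^ 3 / 6 + 5 / 96 * ε ^ 4) * (8165 / 10000) * ε := by ring
    _ < 1 := h

/-- ★ **Row 1g cell `(β⋆_W, ε, q) = (1/16, 0.143, 2)` is a MASSIVE row** (rb-p1 `su2_rowBS2_1_16` — the tier-2 twin of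
the headline radius `0.143` of row 1a): every member of `MemBallZdS 0.286 0.143 (log 2)` added to `SU(2)` Wilson at
`β_W = 1/16` on `ℤ⁴` has DLR states, all massive (rate `log 2`) with plaquette–plaquette decay. -/
theorem su2_massiveS_rowBS2_1_16 {W : Potential (ZdEdge 4) (Matrix.specialUnitaryGroup (Fin 2) ℂ)}
    (hW : MemBallZdS (2 * (143 / 1000)) (143 / 1000) (Real.log 2) W) :
    (perturbedGibbsMeasuresS (d := 4) (fundamentalRep (Fin 2)) (((2 : ℕ) : ℝ) * ((1 / 16 : ℝ) / 4)) W).Nonempty ∧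
      ∀ μ ∈ perturbedGibbsMeasuresS (d := 4) (fundamentalRep (Fin 2)) (((2 : ℕ) : ℝ) * ((1 / 16 : ℝ) / 4)) W,
        IsMassiveState μ ∧ HasExponentialDecay (plaquetteCorrFn (fundamentalRep (Fin 2)) μ) :=
  su2_massiveS_rowBS (by norm_num) (by norm_num) (by norm_num) (by norm_num) (by norm_num) (by norm_num) hW

/-- **Largest coupling of the lineage-(B) column, `(β⋆_W, ε, q) = (1/12, 0.049, 2)`, is a MASSIVE row**
(rb-p1 `su2_rowBS2_1_12`). -/
theorem su2_massiveS_rowBS2_1_12 {W : Potential (ZdEdge 4) (Matrix.specialUnitaryGroup (Fin 2) ℂ)}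
    (hW : MemBallZdS (2 * (49 / 1000)) (49 / 1000) (Real.log 2) W) :
    (perturbedGibbsMeasuresS (d := 4) (fundamentalRep (Fin 2)) (((2 : ℕ) : ℝ) * ((1 / 12 : ℝ) / 4)) W).Nonempty ∧
      ∀ μ ∈ perturbedGibbsMeasuresS (d := 4) (fundamentalRep (Fin 2)) (((2 : ℕ) : ℝ) * ((1 / 12 : ℝ) / 4)) W,
        IsMassiveState μ ∧ HasExponentialDecay (plaquetteCorrFn (fundamentalRep (Fin 2)) μ) :=
  su2_massiveS_rowBS (by norm_num) (by norm_num) (by norm_num) (by norm_num) (by norm_num) (by norm_num) hW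

/-! ### All `N ≥ 2`, hypothesis-free: the cell `(β, a, Λ, q) = (1/64, 1/20, 1/10, 6/5)` of rb-p1's `RowsSN` -/

/-- ★ **ALL `N ≥ 2`, `ℤ⁴`, HYPOTHESIS-FREE tier-2 MASSIVE row** (the cell of rb-p1's `suN_rowS_1_64`, same
Bakry–Émery door, same certificate `(9/13)(6/5) e^{1/20} + e^{1/40}/(10 √(13 N/32)) ≤ 0.98717 < 1`): at `SU(N)`
coupling `β = 1/64` every member of the weighted ball with oscillation load `≤ 1/20` and `e^{t‖·‖∞}`-weighted
cross load `≤ 1/10` at `e^{t} = 6/5` has DLR states, and every DLR state is MASSIVE (rate `log (6/5)`) with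
plaquette–plaquette decay. -/
theorem suN_massiveS_rowS_1_64 {N : ℕ} (hN : 2 ≤ N)
    {W : Potential (ZdEdge 4) (Matrix.specialUnitaryGroup (Fin N) ℂ)}
    (hW : MemBallZdS (1 / 20) (1 / 10) (Real.log (6 / 5)) W) :
    (perturbedGibbsMeasuresS (d := 4) (fundamentalRep (Fin N)) ((N : ℝ) * (1 / 64)) W).Nonempty ∧
      ∀ μ ∈ perturbedGibbsMeasuresS (d := 4) (fundamentalRep (Fin N)) ((N : ℝ) * (1 / 64)) W,
        IsMassiveState μ ∧ HasExponentialDecay (plaquetteCorrFn (fundamentalRep (Fin N)) μ) := by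
  have hq : Real.exp (Real.log (6 / 5)) = 6 / 5 := Real.exp_log (by norm_num)
  have hN2 : (2 : ℝ) ≤ N := by exact_mod_cast hN
  refine suN_massive_onBallZdS_bakryEmery_dim4 hN (Real.log_pos (by norm_num))
    (by rw [abs_of_pos (by norm_num : (0 : ℝ) < 1 / 64)]; norm_num) ?_ hW
  rw [hq, abs_of_pos (by norm_num : (0 : ℝ) < 1 / 64)]
  have h1 := exp_le_taylor4 (x := 1 / 20) (by norm_num) (by norm_num)
  have h2 := exp_le_taylor4 (x := 1 / 20 / 2) (by norm_num) (by norm_num)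
  -- the `N`-dependent denominator is smallest at `N = 2`; `√(13/16) ≥ 0.901`
  have hgap : (1 / 2 - 1 / 64 * (2 * (((4 : ℕ) : ℝ) - 1))) = 13 / 32 := by norm_num
  rw [hgap]
  have hsq : (901 / 1000 : ℝ) ≤ Real.sqrt (13 / 16) := Real.le_sqrt_of_sq_le (by norm_num)
  have hs : (901 / 1000 : ℝ) ≤ Real.sqrt ((N : ℝ) * (13 / 32)) := by
    refine hsq.trans (Real.sqrt_le_sqrt ?_)
    nlinarith
  have hs0 : (0 : ℝ) < Real.sqrt ((N : ℝ) * (13 / 32)) := by linarith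
  have hsecond : Real.exp (1 / 20 / 2) * (1 / 10) / Real.sqrt ((N : ℝ) * (13 / 32)) ≤
      (1 + 1 / 20 / 2 + (1 / 20 / 2) ^ 2 / 2 + (1 / 20 / 2) ^ 3 / 6 + 5 / 96 * (1 / 20 / 2) ^ 4) * (1 / 10) /
        (901 / 1000) := by
    rw [div_le_div_iff₀ hs0 (by norm_num)]
    have he0 : 0 < Real.exp (1 / 20 / 2) := Real.exp_pos _
    nlinarith [hs, h2, he0]
  have hfirst : 6 * (((4 : ℕ) : ℝ) - 1) * (1 / 64) * (Real.exp (1 / 20) * (6 / 5)) / (13 / 32) ≤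
      6 * 3 * (1 / 64) * ((1 + 1 / 20 + (1 / 20) ^ 2 / 2 + (1 / 20) ^ 3 / 6 + 5 / 96 * (1 / 20) ^ 4) * (6 / 5)) /
        (13 / 32) := by
    push_cast
    gcongr
    norm_num
  calc 6 * (((4 : ℕ) : ℝ) - 1) * (1 / 64) * (Real.exp (1 / 20) * (6 / 5)) / (13 / 32) +
        Real.exp (1 / 20 / 2) * (1 / 10) / Real.sqrt ((N : ℝ) * (13 / 32))
      ≤ 6 * 3 * (1 / 64) * ((1 + 1 / 20 + (1 / 20) ^ 2 / 2 + (1 / 20) ^ 3 / 6 + 5 / 96 * (1 / 20) ^ 4) * (6 / 5)) /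
          (13 / 32) +
        (1 + 1 / 20 / 2 + (1 / 20 / 2) ^ 2 / 2 + (1 / 20 / 2) ^ 3 / 6 + 5 / 96 * (1 / 20 / 2) ^ 4) * (1 / 10) /
          (901 / 1000) := add_le_add hfirst hsecond
    _ < 1 := by norm_num

/-! ### `SU(3)` on the cell's certificates H1/H2: the cells of rb-p1's `RowsSN.su3_rowS*` -/

/-- **`SU(3)` tier-2 MASSIVE row schema on the certificates** (the hypotheses of rb-p1's `su3_rowS` verbatim +
membership): `(14/5) β_W q T(2ε) + 0.8945 ε T(ε) < 1`, `0 ≤ β_W`, `3β_W ≤ 33/20`, CONDITIONAL on H1/H2 ⇒ every member of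
`MemBallZdS (2ε) ε (log q)` added to `SU(3)` Wilson at `β_W` on `ℤ⁴` has DLR states, all MASSIVE (rate `log q`) with
plaquette–plaquette decay. -/
theorem su3_massiveS_row {βW ε q : ℝ} (hP : OneLinkPoincareSUN 3 (3 / 5) (4 / 5))
    (hV : OneLinkVarianceBound 3 (11 / 30) (49 / 20)) (hq : 1 < q) (hβ : 0 ≤ βW) (hβR : 3 * βW ≤ 33 / 20)
    (hε0 : 0 ≤ ε) (hε1 : ε ≤ 1 / 2)
    (h : 14 / 5 * βW * q * (1 + 2 * ε + (2 * ε) ^ 2 / 2 + (2 * ε) ^ 3 / 6 + 5 / 96 * (2 * ε) ^ 4) +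
      (1 + ε + ε ^ 2 / 2 + ε ^ 3 / 6 + 5 / 96 * ε ^ 4) * (8945 / 10000) * ε < 1)
    {W : Potential (ZdEdge 4) (Matrix.specialUnitaryGroup (Fin 3) ℂ)} (hW : MemBallZdS (2 * ε) ε (Real.log q) W) :
    (perturbedGibbsMeasuresS (d := 4) (fundamentalRep (Fin 3)) (((3 : ℕ) : ℝ) * (βW / 9)) W).Nonempty ∧
      ∀ μ ∈ perturbedGibbsMeasuresS (d := 4) (fundamentalRep (Fin 3)) (((3 : ℕ) : ℝ) * (βW / 9)) W,
        IsMassiveState μ ∧ HasExponentialDecay (plaquetteCorrFn (fundamentalRep (Fin 3)) μ) := by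
  have hq0 : 0 < q := zero_lt_one.trans hq
  refine su3_massive_onBallZdS_of_certificates hP hV (by rw [abs_of_nonneg hβ]; push_cast; linarith)
    (Real.log_pos hq) ?_ hW
  have h1 := exp_le_taylor4 (x := 2 * ε) (by linarith) (by linarith)
  have h2 := exp_le_taylor4 (x := ε) hε0 (by linarith)
  rw [abs_of_nonneg hβ, show 2 * ε / 2 = ε by ring, Real.exp_log hq0]
  have hs := sqrt_four_fifths_le
  have hs0 : 0 ≤ Real.sqrt (4 / 5 : ℝ) := Real.sqrt_nonneg _
  push_cast
  calc 14 / 15 * (((4 : ℝ) - 1) * βW) * (Real.exp (2 * ε) * q) + Real.exp ε * Real.sqrt (4 / 5) * ε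
      ≤ 14 / 15 * ((4 - 1) * βW) * ((1 + 2 * ε + (2 * ε) ^ 2 / 2 + (2 * ε) ^ 3 / 6 + 5 / 96 * (2 * ε) ^ 4) * q) +
        (1 + ε + ε ^ 2 / 2 + ε ^ 3 / 6 + 5 / 96 * ε ^ 4) * (8945 / 10000) * ε := by
        gcongr
    _ = 14 / 5 * βW * q * (1 + 2 * ε + (2 * ε) ^ 2 / 2 + (2 * ε) ^ 3 / 6 + 5 / 96 * (2 * ε) ^ 4) +
        (1 + ε + ε ^ 2 / 2 + ε ^ 3 / 6 + 5 / 96 * ε ^ 4) * (8945 / 10000) * ε := by ring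
    _ < 1 := h

/-- **`SU(3)` cell (H1/H2) `(β⋆_W, ε, q) = (1/8, 0.199, 3/2)` is a MASSIVE row** (rb-p1 `su3_rowS32_1_8`). -/
theorem su3_massiveS_rowS32_1_8 (hP : OneLinkPoincareSUN 3 (3 / 5) (4 / 5))
    (hV : OneLinkVarianceBound 3 (11 / 30) (49 / 20)) {W : Potential (ZdEdge 4) (Matrix.specialUnitaryGroup (Fin 3) ℂ)}
    (hW : MemBallZdS (2 * (199 / 1000)) (199 / 1000) (Real.log (3 / 2)) W) :
    (perturbedGibbsMeasuresS (d := 4) (fundamentalRep (Fin 3)) (((3 : ℕ) : ℝ) * ((1 / 8 : ℝ) / 9)) W).Nonempty ∧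
      ∀ μ ∈ perturbedGibbsMeasuresS (d := 4) (fundamentalRep (Fin 3)) (((3 : ℕ) : ℝ) * ((1 / 8 : ℝ) / 9)) W,
        IsMassiveState μ ∧ HasExponentialDecay (plaquetteCorrFn (fundamentalRep (Fin 3)) μ) :=
  su3_massiveS_row hP hV (by norm_num) (by norm_num) (by norm_num) (by norm_num) (by norm_num) (by norm_num) hW

/-- **`SU(3)` cell (H1/H2) `(β⋆_W, ε, q) = (1/10, 0.181, 2)` is a MASSIVE row** (rb-p1 `su3_rowS2_1_10`). -/
theorem su3_massiveS_rowS2_1_10 (hP : OneLinkPoincareSUN 3 (3 / 5) (4 / 5))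
    (hV : OneLinkVarianceBound 3 (11 / 30) (49 / 20)) {W : Potential (ZdEdge 4) (Matrix.specialUnitaryGroup (Fin 3) ℂ)}
    (hW : MemBallZdS (2 * (181 / 1000)) (181 / 1000) (Real.log 2) W) :
    (perturbedGibbsMeasuresS (d := 4) (fundamentalRep (Fin 3)) (((3 : ℕ) : ℝ) * ((1 / 10 : ℝ) / 9)) W).Nonempty ∧
      ∀ μ ∈ perturbedGibbsMeasuresS (d := 4) (fundamentalRep (Fin 3)) (((3 : ℕ) : ℝ) * ((1 / 10 : ℝ) / 9)) W,
        IsMassiveState μ ∧ HasExponentialDecay (plaquetteCorrFn (fundamentalRep (Fin 3)) μ) :=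
  su3_massiveS_row hP hV (by norm_num) (by norm_num) (by norm_num) (by norm_num) (by norm_num) (by norm_num) hW

end Summit.Ventures.YMGap.RobustBall

end
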